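import Literature.Topology.FourManifolds.K2LiteBandGen2
import Literature.Topology.FourManifolds.K2LiteUpGen2
import Literature.Topology.FourManifolds.K2LiteDerivBounds
import Literature.Topology.FourManifolds.SlideTipMargins
import Literature.Topology.FourManifolds.SlideConstantsBase
import Literature.Topology.FourManifolds.RouteMonotone
import HarnessLib

/-!
# The slide set-up, I: the parameter choice and the two K₂ tracks

Topic `Literature/Topology/FourManifolds`; fact seat `provefact-IsStrictHandleSlide.isSurgery`
(R. C. Kirby, *The Topology of 4-Manifolds*, LNM 1374 (1989), Ch. I §4, Fig. 4.2; remaining content: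
the named fact (S) `Literature.Topology.FourManifolds.FramedLink.IsStrictHandleSlide.slideModel`).
The analytic layer of the handle slide (tracks `K2Lite*`, fingertip `K1Loop2*`, route/fingertip
monotonicity `RouteMonotone*`, `FingerMonotone`, twist `TwistChoice`, margins `SlideTipMargins`)
is quantified over explicit constants subject to explicit inequalities. This file fixes the
**parameter record** of a slide (`BandCore.SlideChoice`: the approach width `μ`, the descent slope
`m_s`, the bend divisor `N`, the tip depth `κ_D`, the gentle slope `λ`, together with the band
constants `C_T, e₋, e₊, Me, mΘ, MΘ` and the inequalities used downstream), derives from it the two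
K₂ tracks `dl = k2liteGen2 …`, `du = k2liteUpGen2 …`, the tip heights `h_D ∈ (hr0, hr1) ⊆
[0.33, 0.45]`, `h_Dᵘ ∈ [0.55, 0.67]`, the height window of the final approach
(`H₁ [t_D, t_L] ⊆ [hr0 - μ, hr1]`), and the twist/axis data of the two tips (`TwistChoice.lean`).
The existence of a `SlideChoice` for every flat-end band is proved in part IV.

## References

* R. C. Kirby, *The Topology of 4-Manifolds*, LNM 1374, Springer (1989), Ch. I §4. [Kirby1989]
-/

open scoped Topology ContDiff
open Set Real Filter

noncomputable section

namespace Literature.Topology.FourManifolds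

/-! ### Height facts of a K₂ track at the tip and on the approach -/

namespace K2LiteData

variable (d : K2LiteData)

/-- The tip height is above `hr0`. [folklore] -/
theorem hr0_lt_Hh_tD : d.hr0 < d.Hh d.tD :=
  d.hr0_lt_of_lt_ρt (by rw [d.ρt_Hh_tD]; exact d.one_sub_κ₀_lt_xD)

/-- On `[t_D, t_L]` the raw height is below `hr1`. [folklore] -/
theorem Hh_lt_hr1 {τ : ℝ} (hτ : τ ∈ Icc d.tD d.tL) : d.Hh τ < d.hr1 := by
  have hX := d.Xl_mem_I hτ
  have hρ : d.ρt (d.Hh τ) = 1 - d.κ₀ + d.Sr (d.Hh τ) :=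
    d.ρt_eq_of_lt_ρt (by show 1 - d.κ₀ < d.Xl τ; linarith [hX.1, d.one_sub_κ₀_lt_xD])
  have hS : d.Sr (d.Hh τ) < 1 := by
    have : d.Xl τ = 1 - d.κ₀ + d.Sr (d.Hh τ) := hρ
    linarith [hX.2, d.κ₀_lt_one]
  exact d.Sr_lt_one_iff.1 hS

/-- `Hh_tD_lt_hr1` (auxiliary). [folklore] -/
theorem Hh_tD_lt_hr1 : d.Hh d.tD < d.hr1 := d.Hh_lt_hr1 ⟨le_rfl, d.tD_lt_tL.le⟩

/-- **The heights of the final approach**: on `[t_D, t_L]`, `H₁ ∈ [hr0 - 3 m_s κ_D, hr1]`. [folklore] -/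
theorem H₁_mem_approach {τ : ℝ} (hτ : τ ∈ Icc d.tD d.tL) : d.H₁ τ ∈ Icc (d.hr0 - 3 * d.ms * d.κD) d.hr1 := by
  rw [d.H₁_eq_P hτ]
  have hXg : d.Xg τ ≤ 1 + 2 * d.κD := by rw [d.Xg_eq hτ]; linarith [(d.Xl_mem_I hτ).2, d.κD_pos]
  have h1 := d.P_ge hXg
  have h2 := d.P_le_Hh τ
  have h3 : d.Hh d.tD ≤ d.Hh τ := d.Hh_le_Hh hτ.1 (d.le_bε hτ)
  exact ⟨by linarith [d.hr0_lt_Hh_tD], by linarith [d.Hh_lt_hr1 hτ]⟩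

end K2LiteData

namespace BandCore

variable {A B : Knot} {avoid : Set (Metric.sphere (0 : EuclideanSpace ℝ (Fin 4)) 1)} (c : BandCore A B avoid)

/-! ### Band-level constants entering the conditions -/

/-- The lower bound of the tip angles: `θ_low = 2 arctan (e^{-2 cmax})`. [folklore] -/
def θlow : ℝ := 2 * arctan (exp (-(2 * c.cmax)))

/-- `θlow_pos` (auxiliary). [folklore] -/
theorem θlow_pos : 0 < c.θlow := by
  have := arctan_strictMono (exp_pos (-(2 * c.cmax))); rw [arctan_zero] at this
  rw [θlow]; linarith

/-- `θlow_le_pi_div_two` (auxiliary). [folklore] -/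
theorem θlow_le_pi_div_two : c.θlow ≤ π / 2 := by
  have h : arctan (exp (-(2 * c.cmax))) ≤ arctan 1 := by
    apply arctan_strictMono.monotone
    rw [← exp_zero]; exact exp_le_exp.2 (by linarith [c.cmax_nonneg])
  rw [arctan_one] at h; rw [θlow]; linarith

/-- The upper bound `q₊ = e^{2 cmax} / sin² (θ_low/4)` of `twistQ` on the routes. [folklore] -/
def qmaxc : ℝ := exp (c.cmax * 2) / sin (c.θlow / 4) ^ 2

/-- The lower bound `q₋ = e^{-2 cmax}` of `twistQ`. [folklore] -/
def qminc : ℝ := exp (-(c.cmax * 2))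

/-- The upper bound `Q_F = e^{2 cmax} / sin² (θ_low/2)` of `twistQ` on the fingertip. [folklore] -/
def QF : ℝ := exp (c.cmax * 2) / sin (c.θlow / 2) ^ 2

/-- `sin_θlow_quarter_pos` (auxiliary). [folklore] -/
theorem sin_θlow_quarter_pos : 0 < sin (c.θlow / 4) :=
  sin_pos_of_pos_of_lt_pi (by linarith [c.θlow_pos]) (by linarith [c.θlow_le_pi_div_two, pi_pos])

/-- `sin_θlow_half_pos` (auxiliary). [folklore] -/
theorem sin_θlow_half_pos : 0 < sin (c.θlow / 2) :=
  sin_pos_of_pos_of_lt_pi (by linarith [c.θlow_pos]) (by linarith [c.θlow_le_pi_div_two, pi_pos])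

/-- `qmaxc_pos` (auxiliary). [folklore] -/
theorem qmaxc_pos : 0 < c.qmaxc := div_pos (exp_pos _) (pow_pos c.sin_θlow_quarter_pos 2)
/-- `qminc_pos` (auxiliary). [folklore] -/
theorem qminc_pos : 0 < c.qminc := exp_pos _
/-- `QF_pos` (auxiliary). [folklore] -/
theorem QF_pos : 0 < c.QF := div_pos (exp_pos _) (pow_pos c.sin_θlow_half_pos 2)

/-- The explicit profile-derivative bound of the lower track family (`K2LiteData.Mρ_of`). [folklore] -/
def Mρlo (CT μ : ℝ) : ℝ :=
  (1 - 2⁻¹) * (CT / ((c.fLo (c.alo + c.epsLo) + c.fLo (c.tlo - c.epsLo - c.epsLo)) / 2 - c.fLo (c.alo + c.epsLo))) +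
    CT / (c.liteHr1μ μ - (c.liteHr1μ μ - μ))

/-- The explicit profile-derivative bound of the upper track family. [folklore] -/
def Mρup (CT μ : ℝ) : ℝ :=
  (1 - 2⁻¹) * (CT / ((c.fUpR (-c.ahi + c.epsHi) + c.fUpR (-c.thi - c.epsHi - c.epsHi)) / 2 - c.fUpR (-c.ahi + c.epsHi))) +
    CT / (c.liteHr1μU μ - (c.liteHr1μU μ - μ))

/-- The bound `MḢ = MH + m_s (1 + C_T) (Mρ MH)` of the route height speed. [folklore] -/
def routeMH' (MH ms CT Mρ : ℝ) : ℝ := MH + ms * (1 + CT) * (Mρ * MH)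

/-- **The parameter record of a slide with a flat end of rate `e`.** Values and the inequalities
consumed downstream; an instance exists for every band with a flat end (part IV).
[cite: Kirby1989, Ch. I §4] -/
structure SlideChoice (e : ℝ → ℝ) where
  /-- bound of `smoothTransition'` -/
  CT : ℝ
  CT_ge : ∀ x, deriv smoothTransition x ≤ CT
  CT_nonneg : 0 ≤ CT
  /-- rate bounds on `[0.12, 0.88]` -/
  emin : ℝ
  emax : ℝ
  Me : ℝ
  emin_pos : 0 < emin
  e_bounds : ∀ h ∈ Icc (0.12 : ℝ) 0.88, emin ≤ e h ∧ e h ≤ emax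
  e_deriv : ∀ h ∈ Icc (0.12 : ℝ) 0.88, |deriv e h| ≤ Me
  /-- angle rate bounds on `[0.12, 0.88]` -/
  mΘ : ℝ
  MΘ : ℝ
  mΘ_pos : 0 < mΘ
  Θ_deriv : ∀ h ∈ Icc (0.12 : ℝ) 0.88, -MΘ ≤ deriv c.ΘB h ∧ deriv c.ΘB h ≤ -mΘ
  /-- approach width -/
  μ : ℝ
  μ_pos : 0 < μ
  μ_le : μ ≤ 100⁻¹
  μ_angle : 8 * μ * MΘ ≤ c.θlow
  /-- profile-derivative bound -/
  Mρ : ℝ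
  Mρ_pos : 0 < Mρ
  Mρ_geₗ : c.Mρlo CT μ ≤ Mρ
  Mρ_geᵤ : c.Mρup CT μ ≤ Mρ
  /-- descent slope -/
  ms : ℝ
  ms_geₗ : c.liteMs2 μ_pos ≤ ms
  ms_geᵤ : c.liteMsU2 μ_pos ≤ ms
  /-- bend divisor -/
  N : ℝ
  N_ge : 2 ≤ N
  /-- gentle slope of the fingertip -/
  lam : ℝ
  lam_pos : 0 < lam
  lam_leₗ : lam * c.liteMH ≤ c.liteVmin2 μ_pos * emin / 2
  lam_leᵤ : lam * c.liteMHU ≤ c.liteVminU2 μ_pos * emin / 2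
  lam_gentle : (1 + CT) * lam * (c.cmax + 1) ≤ c.qminc * mΘ / 2
  lam_clamp : lam * (emin / (4 * (Mρ * emax + Me)) + 2 * c.cmax * emax / (c.qminc * mΘ)) ≤ 3 * emin / 8
  /-- tip depth -/
  κD : ℝ
  κD_pos : 0 < κD
  κD_leₖ : κD ≤ liteKmaxGen ms
  κD_μ : 3 * ms * κD ≤ μ
  κD_e : κD * emax ≤ emin
  κD_e' : κD * emax ≤ 1
  κD_Meₗ : 2 * κD * Me * c.liteMH ≤ c.liteVmin2 μ_pos * emin
  κD_Meᵤ : 2 * κD * Me * c.liteMHU ≤ c.liteVminU2 μ_pos * emin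
  /-- route conditions, lower -/
  cond1ₗ : 2 * κD * Me * routeMH' c.liteMH ms CT Mρ ≤ c.liteVmin2 μ_pos * emin
  cond_sₗ : c.cmax * κD * emax + c.qmaxc * MΘ * routeMH' c.liteMH ms CT Mρ * κD / c.liteVmin2 μ_pos ≤ 2⁻¹
  cond2ₗ : 4 * c.cmax * (c.cmax * κD * emax + c.qmaxc * MΘ * routeMH' c.liteMH ms CT Mρ * κD / c.liteVmin2 μ_pos) ≤ 1
  cond3ₗ : 16 * (c.qmaxc * MΘ * routeMH' c.liteMH ms CT Mρ) *
    (c.cmax * κD * emax + c.qmaxc * MΘ * routeMH' c.liteMH ms CT Mρ * κD / c.liteVmin2 μ_pos) < c.liteVmin2 μ_pos * emin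
  cond5ₗ : κD / N * (c.cmax * emax + c.cmax * κD * Me * routeMH' c.liteMH ms CT Mρ / c.liteVmin2 μ_pos +
      c.qmaxc * MΘ * routeMH' c.liteMH ms CT Mρ / c.liteVmin2 μ_pos) + c.cmax * κD * emax
    < c.qminc * mΘ * ms * κD / 8
  /-- route conditions, upper -/
  cond1ᵤ : 2 * κD * Me * routeMH' c.liteMHU ms CT Mρ ≤ c.liteVminU2 μ_pos * emin
  cond_sᵤ : c.cmax * κD * emax + c.qmaxc * MΘ * routeMH' c.liteMHU ms CT Mρ * κD / c.liteVminU2 μ_pos ≤ 2⁻¹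
  cond2ᵤ : 4 * c.cmax * (c.cmax * κD * emax + c.qmaxc * MΘ * routeMH' c.liteMHU ms CT Mρ * κD / c.liteVminU2 μ_pos) ≤ 1
  cond3ᵤ : 16 * (c.qmaxc * MΘ * routeMH' c.liteMHU ms CT Mρ) *
    (c.cmax * κD * emax + c.qmaxc * MΘ * routeMH' c.liteMHU ms CT Mρ * κD / c.liteVminU2 μ_pos) < c.liteVminU2 μ_pos * emin
  cond5ᵤ : κD / N * (c.cmax * emax + c.cmax * κD * Me * routeMH' c.liteMHU ms CT Mρ / c.liteVminU2 μ_pos +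
      c.qmaxc * MΘ * routeMH' c.liteMHU ms CT Mρ / c.liteVminU2 μ_pos) + c.cmax * κD * emax
    < c.qminc * mΘ * ms * κD / 8
  /-- fingertip conditions (both halves; `β + 2Δh_c`-type zone widths) -/
  fingerA : MΘ * (κD * emin / (4 * (Mρ * emax + Me)) + 2 * c.cmax * κD * emax / (c.qminc * mΘ)) ≤ c.θlow / 2
  fingerB : 2 * MΘ * κD * emax ≤ lam * c.θlow
  fingerMeet : 20 * κD * emax ≤ lam
  β_small : κD * emin / (4 * (Mρ * emax + Me)) ≤ 100⁻¹
  condF1c : c.cmax * κD * emax + c.QF * MΘ * (κD * emin / (4 * (Mρ * emax + Me)) + 2 * c.cmax * κD * emax / (c.qminc * mΘ)) ≤ 2⁻¹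
  condF1c' : 8 * c.cmax * (c.cmax * κD * emax +
    c.QF * MΘ * (κD * emin / (4 * (Mρ * emax + Me)) + 2 * c.cmax * κD * emax / (c.qminc * mΘ))) ≤ 1
  condF2c : 16 * (c.QF * MΘ) * (c.cmax * κD * emax +
    c.QF * MΘ * (κD * emin / (4 * (Mρ * emax + Me)) + 2 * c.cmax * κD * emax / (c.qminc * mΘ))) < lam

namespace SlideChoice

variable {c} {e : ℝ → ℝ} (P : c.SlideChoice e)

/-- `ms_pos` (auxiliary). [folklore] -/
theorem ms_pos : 0 < P.ms := (c.liteMs2_pos P.μ_pos).trans_le P.ms_geₗ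

/-- `N_pos` (auxiliary). [folklore] -/
theorem N_pos : 0 < P.N := by linarith [P.N_ge]

/-- `κD_le_eighth` (auxiliary). [folklore] -/
theorem κD_le_eighth : P.κD ≤ 8⁻¹ := P.κD_leₖ.trans (liteKmaxGen_le _)

/-- The landing width `εℓ = κ_D / 4`. [folklore] -/
def εℓ : ℝ := P.κD / 4

/-- The bend width `u₁ = κ_D / N`. [folklore] -/
def u₁ : ℝ := P.κD / P.N

/-- `εℓ_pos` (auxiliary). [folklore] -/
theorem εℓ_pos : 0 < P.εℓ := by rw [εℓ]; linarith [P.κD_pos]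
/-- `εℓ_le` (auxiliary). [folklore] -/
theorem εℓ_le : 4 * P.εℓ ≤ P.κD := by rw [εℓ]; linarith
/-- `u₁_pos` (auxiliary). [folklore] -/
theorem u₁_pos : 0 < P.u₁ := div_pos P.κD_pos P.N_pos
/-- `u₁_le` (auxiliary). [folklore] -/
theorem u₁_le : P.u₁ ≤ P.κD := by
  rw [u₁, div_le_iff₀ P.N_pos]; nlinarith [P.N_ge, P.κD_pos]
/-- `two_u₁_le` (auxiliary). [folklore] -/
theorem two_u₁_le : 2 * P.u₁ ≤ P.κD := by
  rw [u₁]; rw [show 2 * (P.κD / P.N) = 2 * P.κD / P.N by ring, div_le_iff₀ P.N_pos]; nlinarith [P.N_ge, P.κD_pos]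

/-- **The lower K₂ track of the slide.** [folklore] -/
def dl : K2LiteData := c.k2liteGen2 P.μ_pos P.μ_le P.ms_geₗ P.κD_pos P.κD_leₖ P.εℓ_pos P.εℓ_le P.u₁_pos P.u₁_le

/-- **The upper (reflected) K₂ track of the slide.** [folklore] -/
def du : K2LiteData := c.k2liteUpGen2 P.μ_pos P.μ_le P.ms_geᵤ P.κD_pos P.κD_leₖ P.εℓ_pos P.εℓ_le P.u₁_pos P.u₁_le

/-- `dl_κD` (auxiliary). [folklore] -/
@[simp] theorem dl_κD : P.dl.κD = P.κD := rfl
/-- `du_κD` (auxiliary). [folklore] -/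
@[simp] theorem du_κD : P.du.κD = P.κD := rfl
/-- `dl_ms` (auxiliary). [folklore] -/
@[simp] theorem dl_ms : P.dl.ms = P.ms := rfl
/-- `du_ms` (auxiliary). [folklore] -/
@[simp] theorem du_ms : P.du.ms = P.ms := rfl
/-- `dl_u₁` (auxiliary). [folklore] -/
@[simp] theorem dl_u₁ : P.dl.u₁ = P.u₁ := rfl
/-- `du_u₁` (auxiliary). [folklore] -/
@[simp] theorem du_u₁ : P.du.u₁ = P.u₁ := rfl
/-- `dl_hr0` (auxiliary). [folklore] -/
theorem dl_hr0 : P.dl.hr0 = c.liteHr1μ P.μ - P.μ := rfl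
/-- `dl_hr1` (auxiliary). [folklore] -/
theorem dl_hr1 : P.dl.hr1 = c.liteHr1μ P.μ := rfl
/-- `du_hr0` (auxiliary). [folklore] -/
theorem du_hr0 : P.du.hr0 = c.liteHr1μU P.μ - P.μ := rfl
/-- `du_hr1` (auxiliary). [folklore] -/
theorem du_hr1 : P.du.hr1 = c.liteHr1μU P.μ := rfl

/-- The lower approach levels lie in `[0.33, 0.45]`. [folklore] -/
theorem dl_levels : (0.33 : ℝ) ≤ P.dl.hr0 ∧ P.dl.hr1 ≤ 0.45 := by
  rw [dl_hr0, dl_hr1, liteHr1μ]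
  have hε := c.epsLo_pos'
  have hf := c.fLo_mem_window (t := c.tlo - c.epsLo - c.epsLo / 2)
    ⟨by linarith [c.alo_add_lt_tlo_sub], by linarith⟩
  have hμ := P.μ_le; have hμ0 := P.μ_pos
  constructor <;> norm_num at hf ⊢ <;> linarith [hf.1, hf.2]

/-- The upper (reflected) approach levels lie in `[0.33, 0.45]`. [folklore] -/
theorem du_levels : (0.33 : ℝ) ≤ P.du.hr0 ∧ P.du.hr1 ≤ 0.45 := by
  rw [du_hr0, du_hr1, liteHr1μU]
  have hε := c.epsHi_bounds.1
  have hf := c.fUpR_mem_window (τ := -c.thi - c.epsHi - c.epsHi / 2)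
    ⟨by linarith [c.thi_add_lt_ahi_sub], by linarith⟩
  have hμ := P.μ_le; have hμ0 := P.μ_pos
  constructor <;> norm_num at hf ⊢ <;> linarith [hf.1, hf.2]

/-- **The lower tip height** `h_D = Hh t_D`. [folklore] -/
def hD : ℝ := P.dl.Hh P.dl.tD

/-- **The upper tip height** `h_Dᵘ = 1 - Hhᵘ t_Dᵘ`. [folklore] -/
def hDu : ℝ := 1 - P.du.Hh P.du.tD

/-- `hD_mem` (auxiliary). [folklore] -/
theorem hD_mem : P.hD ∈ Ioo P.dl.hr0 P.dl.hr1 := ⟨P.dl.hr0_lt_Hh_tD, P.dl.Hh_tD_lt_hr1⟩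

/-- `hD_mem'` (auxiliary). [folklore] -/
theorem hD_mem' : P.hD ∈ Icc (0.33 : ℝ) 0.45 :=
  ⟨P.dl_levels.1.trans P.hD_mem.1.le, P.hD_mem.2.le.trans P.dl_levels.2⟩

/-- `hDu_mem'` (auxiliary). [folklore] -/
theorem hDu_mem' : P.hDu ∈ Icc (0.55 : ℝ) 0.67 := by
  have h1 := P.du.hr0_lt_Hh_tD; have h2 := P.du.Hh_tD_lt_hr1; have hl := P.du_levels
  rw [hDu]; constructor <;> linarith

/-- On the final approach of the lower track the heights lie in `[hr0 - μ, hr1]`. [folklore] -/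
theorem H₁_approach_lo {τ : ℝ} (hτ : τ ∈ Icc P.dl.tD P.dl.tL) : P.dl.H₁ τ ∈ Icc (P.dl.hr0 - P.μ) P.dl.hr1 := by
  have h := P.dl.H₁_mem_approach hτ
  rw [dl_ms, dl_κD] at h
  exact ⟨by linarith [h.1, P.κD_μ], h.2⟩

/-- `H₁_approach_up` (auxiliary). [folklore] -/
theorem H₁_approach_up {τ : ℝ} (hτ : τ ∈ Icc P.du.tD P.du.tL) : P.du.H₁ τ ∈ Icc (P.du.hr0 - P.μ) P.du.hr1 := by
  have h := P.du.H₁_mem_approach hτ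
  rw [du_ms, du_κD] at h
  exact ⟨by linarith [h.1, P.κD_μ], h.2⟩

end SlideChoice

end BandCore

end Literature.Topology.FourManifolds
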